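import Mathlib
import HarnessLib

set_option linter.dupNamespace false -- `…BirchSwinnertonDyer.BirchSwinnertonDyer…` is the cell's nested layout (D-0017)
set_option autoImplicit false

/-!
# Brick B6-P of the H46 kernel programme: the divisible part and the «corank» of a `p`-primary abelian group with
# finite `p`-torsion, by counting (no structure theorem)

Cell `bsd-2adic` (run/shared/lean/pub/bsd-2adic/), seat `bsd-2adic-tower-1` GEN 36; `--supports stmt-BirchSwinnertonDyer-19271` (helper,
item `OrdKatoHalfAtTwo`, TOWER road; roadmap `HOME/tower/gen36/NOTE-B6-UNIVERSAL-NORMS-GEN36.md` §5′, inputs (S1)/(S2)). THEOREMS ONLY,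
pure algebra (any additive commutative group `A`, subgroups `G ≤ G' ≤ A`, a prime `p`); closes no item; nothing booked; BSD is not
proved by any of this.

For a `p`-primary subgroup `G` whose `p`-torsion `G[p]` is finite, write `E_k = p^k · G[p^{k+1}] ⊆ G[p]` (a decreasing chain of finite
sets, hence STABLE from some `k₁` on, `exists_layerImage_stable`). Then:
* `mem_torsion_add_smul_of_stable` — `G = G[p^{k₁}] + p·G` (induction on the order, using only `E_{t−1} ⊆ E_t` for `t > k₁`);
* `exists_pow_smul_eq_pow_add_smul` — hence `p^{k₁}G = p^{k₁+j}G` for every `j`: the subgroup `D = p^{k₁}G` is `p`-DIVISIBLE and equals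
  the set of infinitely `p`-divisible elements of `G` (`mem_divPart_iff_forall`);
* `divPart_pTorsion_iff` — `D[p] = E_{k₁}` («`E_∞`»);
* `divPart_subset_of_layerImage_eq` — for `G ≤ G'` with the SAME `E_∞`: `D' ⊆ D` (so `D' = D ⊆ G`): a divisible subgroup is determined by
  its `p`-torsion inside a larger one (induction on the order);
* `layerImage_mono` — `E_k(G) ⊆ E_k(G')`;
* `natCard_pTorsion_succ_eq` — `#G[p^{k+1}] = #E_k · #G[p^k]`, whence `natCard_layerImage_le_of_growth` — a growth bound
  `#G[p^k] ≤ C·p^{kR}` (any `C`) forces `#E_∞ ≤ p^R`;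
* `exists_step_eq_of_monotone_le` — pigeonhole: a non-decreasing `ℕ`-sequence bounded by `B` takes equal values at the ends of one of
  any `B + 1` consecutive steps of length `a`.
To avoid definitions the sets `E_k` and `D` enter as parameters pinned by `iff` hypotheses (`hE`, `hD`). Consumer: the Γ_m-invariants
`Sel_∞^{Γ_m}` (`selmerInfty ⊓ layerInvariants m`; growth bound = tree `exists_natCard_fixedBy_torsion_le_of_isTorsion`).
[cite: GreenbergLNM1716, §4 pp. 105–108] Folklore algebra (L. Fuchs, *Infinite Abelian Groups* I (1970), §§20–23).
-/

namespace Summit.BirchSwinnertonDyer.BirchSwinnertonDyer.Theorems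

namespace TorsionEulerChar.B6

variable {A : Type*} [AddCommGroup A] (p : ℕ)

/-! ## §1 The layers `E_k = p^k · G[p^{k+1}]` -/

section Layers

variable (G : AddSubgroup A) (E : ℕ → Set A)
  (hE : ∀ (k : ℕ) (x : A), x ∈ E k ↔ ∃ y ∈ G, p ^ (k + 1) • y = 0 ∧ p ^ k • y = x)

include hE

/-- `E_{k+1} ⊆ E_k`: `p^{k+1} y = p^k (p y)`. [folklore] -/
theorem layerImage_succ_subset (k : ℕ) : E (k + 1) ⊆ E k := by
  intro x hx
  obtain ⟨y, hyG, hy0, hyx⟩ := (hE (k + 1) x).1 hx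
  refine (hE k x).2 ⟨p • y, G.nsmul_mem hyG p, ?_, ?_⟩
  · rw [← mul_nsmul', ← pow_succ]; exact hy0
  · rw [← mul_nsmul', ← pow_succ]; exact hyx

/-- `E_k` is antitone in `k`. [folklore] -/
theorem layerImage_antitone {k l : ℕ} (hkl : k ≤ l) : E l ⊆ E k := by
  induction hkl with
  | refl => exact le_rfl
  | step _ ih => exact (layerImage_succ_subset p G E hE _).trans ih

/-- `E_k ⊆ G[p]`. [folklore] -/
theorem layerImage_subset_pTorsion (k : ℕ) : E k ⊆ {x : A | x ∈ G ∧ p • x = 0} := by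
  intro x hx
  obtain ⟨y, hyG, hy0, rfl⟩ := (hE k x).1 hx
  refine ⟨G.nsmul_mem hyG _, ?_⟩
  rw [← mul_nsmul', ← pow_succ']
  rwa [pow_succ] at hy0

/-- **The chain `E_k` is eventually constant** when `G[p]` is finite. [folklore] -/
theorem exists_layerImage_stable (hfin : {x : A | x ∈ G ∧ p • x = 0}.Finite) :
    ∃ k₁ : ℕ, ∀ k : ℕ, k₁ ≤ k → E k = E k₁ := by
  -- the cardinalities form a non-increasing sequence of naturals
  have hEfin : ∀ k, (E k).Finite := fun k ↦ hfin.subset (layerImage_subset_pTorsion p G E hE k)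
  have hmono : ∀ k l, k ≤ l → (E l).ncard ≤ (E k).ncard := fun k l hkl ↦
    Set.ncard_le_ncard (layerImage_antitone p G E hE hkl) (hEfin k)
  -- a non-increasing ℕ-sequence attains its minimum
  have hne : (Set.range fun k ↦ (E k).ncard).Nonempty := ⟨_, 0, rfl⟩
  obtain ⟨k₁, hk₁⟩ := Nat.sInf_mem hne
  refine ⟨k₁, fun k hk ↦ ?_⟩
  have hle : (E k₁).ncard ≤ (E k).ncard := by
    have h := Nat.sInf_le (s := Set.range fun k ↦ (E k).ncard) ⟨k, rfl⟩
    rwa [← hk₁] at h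
  exact Set.eq_of_subset_of_ncard_le (layerImage_antitone p G E hE hk) hle (hEfin k₁)

/-- **`G = G[p^{k₁}] + p·G` once the chain is stable from `k₁` on**: every `x ∈ G` is `y + p z` with `y, z ∈ G`, `p^{k₁} y = 0`.
Induction on the `p`-power order of `x`: if `p^t x = 0` with `t > k₁` then `p^{t−1}x ∈ E_{t−1} = E_t`, i.e. `p^{t−1} x = p^t w` with
`w ∈ G[p^{t+1}]`, and `x − p w` has order dividing `p^{t−1}`. [folklore] -/
theorem mem_torsion_add_smul_of_stable (hG : ∀ x ∈ G, ∃ n : ℕ, p ^ n • x = 0) {k₁ : ℕ}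
    (hst : ∀ k : ℕ, k₁ ≤ k → E k = E k₁) :
    ∀ x ∈ G, ∃ y ∈ G, ∃ z ∈ G, p ^ k₁ • y = 0 ∧ x = y + p • z := by
  -- claim by induction on `t`: every `x ∈ G` with `p^t x = 0` decomposes
  suffices h : ∀ (t : ℕ) (x : A), x ∈ G → p ^ t • x = 0 → ∃ y ∈ G, ∃ z ∈ G, p ^ k₁ • y = 0 ∧ x = y + p • z by
    intro x hx
    obtain ⟨n, hn⟩ := hG x hx
    exact h n x hx hn
  intro t
  induction t with
  | zero =>
    intro x hx h0
    rw [pow_zero, one_nsmul] at h0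
    exact ⟨0, G.zero_mem, 0, G.zero_mem, by rw [nsmul_zero], by rw [h0, nsmul_zero, add_zero]⟩
  | succ t ih =>
    intro x hx hxt
    by_cases ht : t + 1 ≤ k₁
    · -- small order: `x` itself is the torsion part
      refine ⟨x, hx, 0, G.zero_mem, ?_, by rw [nsmul_zero, add_zero]⟩
      obtain ⟨d, hd⟩ := Nat.exists_eq_add_of_le ht
      rw [hd, pow_add, mul_comm, mul_nsmul', hxt, nsmul_zero]
    · -- `p^t x ∈ E_t = E_{t+1}`
      have hk₁t : k₁ ≤ t := by omega
      have hmem : p ^ t • x ∈ E t := (hE t _).2 ⟨x, hx, hxt, rfl⟩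
      rw [hst t hk₁t, ← hst (t + 1) (by omega)] at hmem
      obtain ⟨w, hwG, -, hw⟩ := (hE (t + 1) _).1 hmem
      -- `x' := x − p w` has `p^t x' = 0`
      have hx' : p ^ t • (x - p • w) = 0 := by
        rw [nsmul_sub, ← mul_nsmul', ← pow_succ, hw, sub_self]
      obtain ⟨y, hyG, z, hzG, hy, hxyz⟩ := ih (x - p • w) (G.sub_mem hx (G.nsmul_mem hwG p)) hx'
      refine ⟨y, hyG, z + w, G.add_mem hzG hwG, hy, ?_⟩
      rw [nsmul_add, ← add_assoc, ← hxyz, sub_add_cancel]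

/-- **`p^{k₁} G = p^{k₁+j} G`**: for `x ∈ G` and every `j` there is `z ∈ G` with `p^{k₁} x = p^{k₁+j} z`. [folklore] -/
theorem exists_pow_smul_eq_pow_add_smul (hG : ∀ x ∈ G, ∃ n : ℕ, p ^ n • x = 0) {k₁ : ℕ}
    (hst : ∀ k : ℕ, k₁ ≤ k → E k = E k₁) (j : ℕ) :
    ∀ x ∈ G, ∃ z ∈ G, p ^ k₁ • x = p ^ (k₁ + j) • z := by
  induction j with
  | zero => exact fun x hx ↦ ⟨x, hx, by rw [add_zero]⟩
  | succ j ih =>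
    intro x hx
    obtain ⟨z, hzG, hz⟩ := ih x hx
    obtain ⟨y, hyG, w, hwG, hy, hzyw⟩ := mem_torsion_add_smul_of_stable p G E hE hG hst z hzG
    refine ⟨w, hwG, ?_⟩
    calc p ^ k₁ • x = p ^ (k₁ + j) • z := hz
      _ = p ^ (k₁ + j) • y + p ^ (k₁ + j) • (p • w) := by rw [hzyw, nsmul_add]
      _ = p ^ j • (p ^ k₁ • y) + p ^ (k₁ + j + 1) • w := by
        rw [← mul_nsmul' y, ← pow_add, add_comm j k₁, ← mul_nsmul' w, ← pow_succ]
      _ = p ^ (k₁ + (j + 1)) • w := by rw [hy, nsmul_zero, zero_add, ← add_assoc]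

end Layers

/-! ## §2 The divisible part `D = p^{k₁} G` -/

section DivPart

variable (G : AddSubgroup A) (E : ℕ → Set A)
  (hE : ∀ (k : ℕ) (x : A), x ∈ E k ↔ ∃ y ∈ G, p ^ (k + 1) • y = 0 ∧ p ^ k • y = x)
  (hG : ∀ x ∈ G, ∃ n : ℕ, p ^ n • x = 0) {k₁ : ℕ} (hst : ∀ k : ℕ, k₁ ≤ k → E k = E k₁)
  (D : Set A) (hD : ∀ x : A, x ∈ D ↔ ∃ y ∈ G, p ^ k₁ • y = x)

include hE hG hst hD

omit hE hG hst in
/-- `D ⊆ G`. [folklore] -/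
theorem divPart_subset : D ⊆ (G : Set A) := by
  intro x hx
  obtain ⟨y, hyG, rfl⟩ := (hD x).1 hx
  exact G.nsmul_mem hyG _

/-- **`D` is the set of infinitely `p`-divisible elements of `G`**: `x ∈ D ↔ ∀ k, ∃ y ∈ G, p^k y = x`. [folklore] -/
theorem mem_divPart_iff_forall (x : A) : x ∈ D ↔ ∀ k : ℕ, ∃ y ∈ G, p ^ k • y = x := by
  constructor
  · intro hx k
    obtain ⟨y, hyG, rfl⟩ := (hD x).1 hx
    obtain ⟨z, hzG, hz⟩ := exists_pow_smul_eq_pow_add_smul p G E hE hG hst k y hyG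
    refine ⟨p ^ k₁ • z, G.nsmul_mem hzG _, ?_⟩
    rw [hz, ← mul_nsmul', ← pow_add, add_comm]
  · intro h
    obtain ⟨y, hyG, hy⟩ := h k₁
    exact (hD x).2 ⟨y, hyG, hy⟩

/-- **`D` is `p`-divisible**: every `x ∈ D` has, for every `j`, a `p^j`-th root in `D`. [folklore] -/
theorem exists_pow_smul_eq_of_mem_divPart (x : A) (hx : x ∈ D) (j : ℕ) : ∃ d ∈ D, p ^ j • d = x := by
  obtain ⟨y, hyG, rfl⟩ := (hD x).1 hx
  obtain ⟨z, hzG, hz⟩ := exists_pow_smul_eq_pow_add_smul p G E hE hG hst j y hyG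
  refine ⟨p ^ k₁ • z, (hD _).2 ⟨z, hzG, rfl⟩, ?_⟩
  rw [hz, ← mul_nsmul', ← pow_add, add_comm]

omit hG hst in
/-- **`D[p] = E_{k₁}`** (the stable layer `E_∞`). [folklore] -/
theorem divPart_pTorsion_iff (x : A) : (x ∈ D ∧ p • x = 0) ↔ x ∈ E k₁ := by
  constructor
  · rintro ⟨hx, hpx⟩
    obtain ⟨y, hyG, rfl⟩ := (hD x).1 hx
    refine (hE k₁ _).2 ⟨y, hyG, ?_, rfl⟩
    rw [pow_succ', mul_nsmul']
    exact hpx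
  · intro hx
    obtain ⟨y, hyG, hy0, hyx⟩ := (hE k₁ x).1 hx
    refine ⟨(hD x).2 ⟨y, hyG, hyx⟩, ?_⟩
    rw [← hyx, ← mul_nsmul', ← pow_succ']
    exact hy0

end DivPart

/-! ## §3 Two subgroups with the same `E_∞` have the same divisible part -/

section Compare

variable (G G' : AddSubgroup A) (hGG' : G ≤ G') (E E' : ℕ → Set A)
  (hE : ∀ (k : ℕ) (x : A), x ∈ E k ↔ ∃ y ∈ G, p ^ (k + 1) • y = 0 ∧ p ^ k • y = x)
  (hE' : ∀ (k : ℕ) (x : A), x ∈ E' k ↔ ∃ y ∈ G', p ^ (k + 1) • y = 0 ∧ p ^ k • y = x)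

include hE hE' hGG'

/-- `E_k(G) ⊆ E_k(G')` for `G ≤ G'`. [folklore] -/
theorem layerImage_mono (k : ℕ) : E k ⊆ E' k := by
  intro x hx
  obtain ⟨y, hyG, hy0, hyx⟩ := (hE k x).1 hx
  exact (hE' k x).2 ⟨y, hGG' hyG, hy0, hyx⟩

/-- **Same `E_∞` ⟹ same divisible part.** If `G ≤ G'` are `p`-primary with finite `p`-torsion, stable indices `k₁, k₁'`, and
`E_{k₁}(G) = E'_{k₁'}(G')`, then `D' = p^{k₁'}G' ⊆ D = p^{k₁}G` (hence `D' ⊆ G`): induction on the order of `x ∈ D'` — `p^{t−1}x ∈ D'[p] =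
E_∞ = D[p]`, `D` is divisible, so some `d ∈ D` has `p^{t−1} d = p^{t−1} x`, and `x − d ∈ D'` has smaller order. [folklore] -/
theorem divPart_subset_of_layerImage_eq (hG : ∀ x ∈ G, ∃ n : ℕ, p ^ n • x = 0) (hG' : ∀ x ∈ G', ∃ n : ℕ, p ^ n • x = 0)
    {k₁ k₁' : ℕ} (hst : ∀ k : ℕ, k₁ ≤ k → E k = E k₁) (hst' : ∀ k : ℕ, k₁' ≤ k → E' k = E' k₁')
    (heq : E k₁ = E' k₁') (D D' : Set A) (hD : ∀ x : A, x ∈ D ↔ ∃ y ∈ G, p ^ k₁ • y = x)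
    (hD' : ∀ x : A, x ∈ D' ↔ ∃ y ∈ G', p ^ k₁' • y = x) : D' ⊆ D := by
  -- `D ⊆ D'`
  have hDD' : D ⊆ D' := by
    intro x hx
    rw [mem_divPart_iff_forall p G E hE hG hst D hD] at hx
    rw [mem_divPart_iff_forall p G' E' hE' hG' hst' D' hD']
    intro k
    obtain ⟨y, hyG, hy⟩ := hx k
    exact ⟨y, hGG' hyG, hy⟩
  -- induction on the order
  suffices h : ∀ (t : ℕ) (x : A), x ∈ D' → p ^ t • x = 0 → x ∈ D by
    intro x hx
    obtain ⟨n, hn⟩ := hG' x (divPart_subset (p := p) (G := G') (D := D') hD' hx)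
    exact h n x hx hn
  intro t
  induction t with
  | zero =>
    intro x _ h0
    rw [pow_zero, one_nsmul] at h0
    rw [h0]
    exact (hD 0).2 ⟨0, G.zero_mem, nsmul_zero _⟩
  | succ t ih =>
    intro x hx hxt
    -- `p^t x ∈ D'[p] = E'_∞ = E_∞ = D[p]`
    have h1 : p ^ t • x ∈ D' ∧ p • (p ^ t • x) = 0 := by
      refine ⟨?_, by rw [← mul_nsmul', ← pow_succ']; exact hxt⟩
      obtain ⟨y, hyG', rfl⟩ := (hD' x).1 hx
      exact (hD' _).2 ⟨p ^ t • y, G'.nsmul_mem hyG' _, by rw [← mul_nsmul', ← mul_nsmul', mul_comm]⟩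
    have h2 : p ^ t • x ∈ D := by
      have h := (divPart_pTorsion_iff p G' E' hE' D' hD' _).1 h1
      rw [← heq] at h
      exact ((divPart_pTorsion_iff p G E hE D hD _).2 h).1
    -- `D` divisible: `d ∈ D` with `p^t d = p^t x`
    obtain ⟨d, hdD, hd⟩ := exists_pow_smul_eq_of_mem_divPart p G E hE hG hst D hD _ h2 t
    -- `x − d ∈ D'` of order dividing `p^t`
    have hxd : x - d ∈ D' := by
      obtain ⟨y, hyG', rfl⟩ := (hD' x).1 hx
      obtain ⟨y', hy'G', hy'⟩ := (hD' d).1 (hDD' hdD)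
      exact (hD' _).2 ⟨y - y', G'.sub_mem hyG' hy'G', by rw [nsmul_sub, hy']⟩
    have hxd0 : p ^ t • (x - d) = 0 := by rw [nsmul_sub, hd, sub_self]
    have := ih (x - d) hxd hxd0
    -- `x = (x − d) + d`
    obtain ⟨y₁, hy₁, hy₁x⟩ := (hD _).1 this
    obtain ⟨y₂, hy₂, hy₂x⟩ := (hD _).1 hdD
    exact (hD x).2 ⟨y₁ + y₂, G.add_mem hy₁ hy₂, by rw [nsmul_add, hy₁x, hy₂x, sub_add_cancel]⟩

end Compare

/-! ## §4 Counting: `#G[p^{k+1}] = #E_k · #G[p^k]`, and a growth bound caps `#E_∞` -/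

section Count

variable (G : AddSubgroup A) (E : ℕ → Set A)
  (hE : ∀ (k : ℕ) (x : A), x ∈ E k ↔ ∃ y ∈ G, p ^ (k + 1) • y = 0 ∧ p ^ k • y = x)

include hE

/-- **`#G[p^{k+1}] = #E_k · #G[p^k]`** (`p^k •` maps `G[p^{k+1}]` onto `E_k` with fibres the cosets of `G[p^k]`). [folklore] -/
theorem natCard_pTorsion_succ_eq (k : ℕ) :
    Nat.card {x : A | x ∈ G ∧ p ^ (k + 1) • x = 0} = Nat.card (E k) * Nat.card {x : A | x ∈ G ∧ p ^ k • x = 0} := by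
  -- the subgroup `T = G[p^{k+1}]` and the hom `φ = p^k • ·` on it
  let T : AddSubgroup A :=
    { carrier := {x : A | x ∈ G ∧ p ^ (k + 1) • x = 0}
      add_mem' := fun {a b} ha hb ↦ ⟨G.add_mem ha.1 hb.1, by rw [nsmul_add, ha.2, hb.2, add_zero]⟩
      zero_mem' := ⟨G.zero_mem, nsmul_zero _⟩
      neg_mem' := fun {a} ha ↦ ⟨G.neg_mem ha.1, by rw [smul_neg, ha.2, neg_zero]⟩ }
  let φ : T →+ A := (nsmulAddMonoidHom (p ^ k) : A →+ A).comp T.subtype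
  -- range = E k, kernel ≃ G[p^k]
  have hrange : (φ.range : Set A) = E k := by
    ext x
    rw [AddMonoidHom.coe_range, Set.mem_range, hE]
    constructor
    · rintro ⟨⟨y, hyG, hy0⟩, rfl⟩
      exact ⟨y, hyG, hy0, rfl⟩
    · rintro ⟨y, hyG, hy0, rfl⟩
      exact ⟨⟨y, hyG, hy0⟩, rfl⟩
  have hker : (φ.ker.map T.subtype : Set A) = {x : A | x ∈ G ∧ p ^ k • x = 0} := by
    ext x
    rw [AddSubgroup.coe_map, Set.mem_image]
    constructor
    · rintro ⟨⟨y, hyG, hy0⟩, hy, rfl⟩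
      rw [SetLike.mem_coe, AddMonoidHom.mem_ker] at hy
      exact ⟨hyG, hy⟩
    · rintro ⟨hxG, hx⟩
      refine ⟨⟨x, hxG, by rw [pow_succ', mul_nsmul', hx, nsmul_zero]⟩, ?_, rfl⟩
      rw [SetLike.mem_coe, AddMonoidHom.mem_ker]
      exact hx
  -- `#T = #range · #ker`
  have h1 : Nat.card T = Nat.card φ.range * Nat.card φ.ker := by
    rw [← Nat.card_congr (QuotientAddGroup.quotientKerEquivRange φ).toEquiv]
    exact AddSubgroup.card_eq_card_quotient_mul_card_addSubgroup _
  have h2 : Nat.card φ.ker = Nat.card (φ.ker.map T.subtype) :=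
    (Nat.card_congr (φ.ker.equivMapOfInjective T.subtype T.subtype_injective).toEquiv)
  rw [h2] at h1
  have h3 : Nat.card (φ.ker.map T.subtype) = Nat.card {x : A | x ∈ G ∧ p ^ k • x = 0} := by
    rw [← hker]; rfl
  have h4 : Nat.card φ.range = Nat.card (E k) := by rw [← hrange]; rfl
  rw [← h3, ← h4, ← h1]
  rfl

/-- Iterating: `#G[p^{k₁+j}] = #G[p^{k₁}] · ∏_{i<j} #E_{k₁+i}`; with the chain stable from `k₁`: `= #G[p^{k₁}] · (#E_{k₁})^j`. [folklore] -/
theorem natCard_pTorsion_add_eq {k₁ : ℕ}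
    (hst : ∀ k : ℕ, k₁ ≤ k → E k = E k₁) (j : ℕ) :
    Nat.card {x : A | x ∈ G ∧ p ^ (k₁ + j) • x = 0} = Nat.card {x : A | x ∈ G ∧ p ^ k₁ • x = 0} * Nat.card (E k₁) ^ j := by
  induction j with
  | zero => rw [add_zero, pow_zero, mul_one]
  | succ j ih =>
    rw [← add_assoc, natCard_pTorsion_succ_eq p G E hE (k₁ + j), ih, hst (k₁ + j) (by omega), pow_succ]
    ring

/-- **A growth bound caps `#E_∞`**: `#G[p^k] ≤ C · p^{kR}` for all `k` forces `#E_{k₁} ≤ p^R` (`k₁` the stable index). [folklore] -/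
theorem natCard_layerImage_le_of_growth (hp : 1 < p) (hfin : ∀ k, {x : A | x ∈ G ∧ p ^ k • x = 0}.Finite) {k₁ : ℕ}
    (hst : ∀ k : ℕ, k₁ ≤ k → E k = E k₁) {C R : ℕ}
    (hgrowth : ∀ k : ℕ, Nat.card {x : A | x ∈ G ∧ p ^ k • x = 0} ≤ C * p ^ (k * R)) :
    Nat.card (E k₁) ≤ p ^ R := by
  by_contra hlt
  rw [not_le] at hlt
  -- `e := #E_{k₁} ≥ p^R + 1`; `#G[p^{k₁}] ≥ 1`; so `e^j ≤ C p^{(k₁+j)R}` for all `j`, impossible for large `j`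
  set e := Nat.card (E k₁) with he
  have hT0 : 1 ≤ Nat.card {x : A | x ∈ G ∧ p ^ k₁ • x = 0} := by
    haveI : Finite {x : A | x ∈ G ∧ p ^ k₁ • x = 0} := hfin k₁
    haveI : Nonempty {x : A | x ∈ G ∧ p ^ k₁ • x = 0} := ⟨⟨0, G.zero_mem, nsmul_zero _⟩⟩
    exact Nat.one_le_iff_ne_zero.2 Nat.card_pos.ne'
  have key : ∀ j : ℕ, e ^ j ≤ C * p ^ (k₁ * R) * (p ^ R) ^ j := by
    intro j
    have h := hgrowth (k₁ + j)
    rw [natCard_pTorsion_add_eq p G E hE hst j] at h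
    calc e ^ j ≤ Nat.card {x : A | x ∈ G ∧ p ^ k₁ • x = 0} * e ^ j := Nat.le_mul_of_pos_left _ hT0
      _ ≤ C * p ^ ((k₁ + j) * R) := h
      _ = C * p ^ (k₁ * R) * (p ^ R) ^ j := by rw [add_mul, pow_add, mul_comm j R, pow_mul p R j, mul_assoc]
  set M := C * p ^ (k₁ * R) with hM
  set q := p ^ R with hq
  have hq1 : 1 ≤ q := Nat.one_le_pow _ _ (by omega)
  have key' : ∀ j : ℕ, (q + 1) ^ j ≤ M * q ^ j := fun j ↦ (Nat.pow_le_pow_left hlt j).trans (key j)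
  -- `(q+1)^j ≥ q^j + j q^{j-1}` ⇒ eventually exceeds `M q^j`; use `(q+1)^j ≥ q^(j-1) * (q + j)`
  have hbin : ∀ j : ℕ, q ^ j * (q + j) ≤ (q + 1) ^ j * q := by
    intro j
    induction j with
    | zero => simp
    | succ j ih =>
      calc q ^ (j + 1) * (q + (j + 1)) = q * (q ^ j * (q + j)) + q ^ j * q := by ring
        _ ≤ q * ((q + 1) ^ j * q) + (q + 1) ^ j * q :=
          Nat.add_le_add (Nat.mul_le_mul_left _ ih) (Nat.mul_le_mul_right _ (Nat.pow_le_pow_left (Nat.le_succ q) j))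
        _ = (q + 1) ^ (j + 1) * q := by ring
  have hfinal := hbin (M * q + 1)
  have hk := key' (M * q + 1)
  have hpos : 0 < q ^ (M * q + 1) := Nat.pow_pos (by omega)
  have : q ^ (M * q + 1) * (q + (M * q + 1)) ≤ q ^ (M * q + 1) * (M * q) := by
    calc q ^ (M * q + 1) * (q + (M * q + 1)) ≤ (q + 1) ^ (M * q + 1) * q := hfinal
      _ ≤ M * q ^ (M * q + 1) * q := Nat.mul_le_mul_right _ hk
      _ = q ^ (M * q + 1) * (M * q) := by ring
  have := Nat.le_of_mul_le_mul_left this hpos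
  omega

end Count

/-! ## §5 Pigeonhole for a bounded non-decreasing sequence -/

/-- **Pigeonhole.** A non-decreasing sequence `f : ℕ → ℕ` bounded by `B` takes the same value at both ends of one of the `B + 1`
consecutive steps `[m₀ + i a, m₀ + (i+1) a]`, `i ≤ B`. [folklore] -/
theorem exists_step_eq_of_monotone_le (f : ℕ → ℕ) (hf : Monotone f) {B : ℕ} (hB : ∀ m, f m ≤ B) (m₀ a : ℕ) :
    ∃ i : ℕ, i ≤ B ∧ f (m₀ + i * a) = f (m₀ + (i + 1) * a) := by
  by_contra h
  push Not at h
  -- every step increases by ≥ 1, so `f (m₀ + (B+1) a) ≥ f m₀ + B + 1 > B`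
  have hstep : ∀ i : ℕ, i ≤ B + 1 → f m₀ + i ≤ f (m₀ + i * a) := by
    intro i
    induction i with
    | zero => simp
    | succ i ih =>
      intro hi
      have h1 := ih (by omega)
      have h2 : f (m₀ + i * a) < f (m₀ + (i + 1) * a) :=
        lt_of_le_of_ne (hf (by nlinarith)) (h i (by omega))
      omega
  have := hstep (B + 1) le_rfl
  have := hB (m₀ + (B + 1) * a)
  omega

end TorsionEulerChar.B6

end Summit.BirchSwinnertonDyer.BirchSwinnertonDyer.Theorems
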